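import Summits.Ventures.HodgeRepro2.T5LevelIdempotent

/-!
# Directed idempotents and non-degenerate modules; smooth = non-degenerate (Tier-5 support, p8)

The abstract half of the Hecke dictionary «smooth representations = non-degenerate modules»:
a DIRECTED FAMILY of idempotents `E` in a ring `R` (any two members have a common upper bound
for the idempotent order `e ≼ f :⟺ e f = e = f e`) and a module `M` is `E`-NON-DEGENERATE when
every vector is fixed by some member of `E` (`M = ⋃_{e ∈ E} e M`).  We prove the bookkeeping
(monotonicity of fixed vectors, the non-degenerate vectors form an additive subgroup, closure of
non-degeneracy under submodules, surjective images, quotients, products), and then instantiate: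
the level idempotents `e_K`, `K ∈ 𝒦`, of `T5LevelIdempotent` form a directed family in
`End_k V` when `𝒦` is closed under common lower bounds (`isDirectedIdempotents_levelIdempotents`),
`V` is non-degenerate over them iff every vector is fixed by some `K ∈ 𝒦`
(`isNondegenerate_levelIdempotents_iff`), and for a cofinal family of open subgroups this is
exactly smoothness (`isSmooth_iff_isNondegenerate`).  What stays prose: the convolution algebra
`H(G)` itself (here only its idempotents `e_K` act, as elements of `End_k V`).
-/

namespace Summit.Ventures.HodgeRepro2.T5DirectedIdempotents

section Abstract

variable {R : Type*} [Ring R]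

/-- The idempotent order: `e ≼ f` iff `e * f = e` and `f * e = e`. -/
def IdemLE (e f : R) : Prop := e * f = e ∧ f * e = e

/-- `≼` is reflexive on idempotents. -/
theorem IdemLE.refl {e : R} (he : IsIdempotentElem e) : IdemLE e e := ⟨he.eq, he.eq⟩

/-- `≼` is transitive. -/
theorem IdemLE.trans {e f g : R} (h₁ : IdemLE e f) (h₂ : IdemLE f g) : IdemLE e g := by
  constructor
  · calc e * g = e * f * g := by rw [h₁.1]
      _ = e * (f * g) := mul_assoc _ _ _
      _ = e * f := by rw [h₂.1]
      _ = e := h₁.1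
  · calc g * e = g * (f * e) := by rw [h₁.2]
      _ = g * f * e := (mul_assoc _ _ _).symm
      _ = f * e := by rw [h₂.2]
      _ = e := h₁.2

/-- A directed family of idempotents: non-empty, every member idempotent, and any two members
have a common upper bound in the family. -/
structure IsDirectedIdempotents (E : Set R) : Prop where
  nonempty : E.Nonempty
  idem : ∀ e ∈ E, IsIdempotentElem e
  directed : ∀ e ∈ E, ∀ f ∈ E, ∃ g ∈ E, IdemLE e g ∧ IdemLE f g

variable {M : Type*} [AddCommGroup M] [Module R M]

/-- A vector fixed by `e` is fixed by every `f ≽ e`. -/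
theorem smul_eq_self_of_idemLE {e f : R} (h : IdemLE e f) {m : M} (hm : e • m = m) : f • m = m :=
  calc f • m = f • (e • m) := by rw [hm]
    _ = (f * e) • m := (mul_smul _ _ _).symm
    _ = e • m := by rw [h.2]
    _ = m := hm

/-- For an idempotent `e`, the fixed vectors of `e` are exactly the image `e • M`. -/
theorem smul_eq_self_iff_exists {e : R} (he : IsIdempotentElem e) {m : M} :
    e • m = m ↔ ∃ n : M, e • n = m := by
  refine ⟨fun h => ⟨m, h⟩, ?_⟩
  rintro ⟨n, rfl⟩
  rw [← mul_smul, he.eq]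

/-- `M` is non-degenerate over `E`: every vector is fixed by some member of `E`
(`M = ⋃_{e ∈ E} e M`). -/
def IsNondegenerate (E : Set R) (M : Type*) [AddCommGroup M] [Module R M] : Prop :=
  ∀ m : M, ∃ e ∈ E, e • m = m

variable {E : Set R}

/-- The non-degenerate vectors `⋃_{e ∈ E} {m | e • m = m}` form an additive subgroup when `E` is
directed. -/
def nondegenerateVectors (hE : IsDirectedIdempotents E) (M : Type*) [AddCommGroup M]
    [Module R M] : AddSubgroup M where
  carrier := {m | ∃ e ∈ E, e • m = m}
  zero_mem' := by
    obtain ⟨e, he⟩ := hE.nonempty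
    exact ⟨e, he, smul_zero e⟩
  add_mem' := by
    rintro m n ⟨e, he, hm⟩ ⟨f, hf, hn⟩
    obtain ⟨g, hg, hge, hgf⟩ := hE.directed e he f hf
    exact ⟨g, hg, by rw [smul_add, smul_eq_self_of_idemLE hge hm, smul_eq_self_of_idemLE hgf hn]⟩
  neg_mem' := by
    rintro m ⟨e, he, hm⟩
    exact ⟨e, he, by rw [smul_neg, hm]⟩

/-- Membership in `nondegenerateVectors`. -/
theorem mem_nondegenerateVectors_iff (hE : IsDirectedIdempotents E) {m : M} :
    m ∈ nondegenerateVectors hE M ↔ ∃ e ∈ E, e • m = m :=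
  Iff.rfl

/-- `M` is non-degenerate iff every vector is non-degenerate. -/
theorem isNondegenerate_iff_eq_top (hE : IsDirectedIdempotents E) :
    IsNondegenerate E M ↔ nondegenerateVectors hE M = ⊤ := by
  rw [eq_top_iff]
  exact ⟨fun h m _ => h m, fun h m => h (AddSubgroup.mem_top m)⟩

/-- A submodule of a non-degenerate module is non-degenerate. -/
theorem IsNondegenerate.submodule (h : IsNondegenerate E M) (N : Submodule R M) :
    IsNondegenerate E N := by
  intro m
  obtain ⟨e, he, hm⟩ := h (m : M)
  exact ⟨e, he, Subtype.ext (by rw [Submodule.coe_smul, hm])⟩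

/-- The image of a non-degenerate module under a surjective linear map is non-degenerate. -/
theorem IsNondegenerate.of_surjective {N : Type*} [AddCommGroup N] [Module R N]
    (h : IsNondegenerate E M) (f : M →ₗ[R] N) (hf : Function.Surjective f) :
    IsNondegenerate E N := by
  intro n
  obtain ⟨m, rfl⟩ := hf n
  obtain ⟨e, he, hm⟩ := h m
  exact ⟨e, he, by rw [← map_smul, hm]⟩

/-- A quotient of a non-degenerate module is non-degenerate. -/
theorem IsNondegenerate.quotient (h : IsNondegenerate E M) (N : Submodule R M) :
    IsNondegenerate E (M ⧸ N) :=
  h.of_surjective N.mkQ N.mkQ_surjective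

/-- A linear equivalence transports non-degeneracy. -/
theorem IsNondegenerate.congr {N : Type*} [AddCommGroup N] [Module R N]
    (h : IsNondegenerate E M) (f : M ≃ₗ[R] N) : IsNondegenerate E N :=
  h.of_surjective f.toLinearMap f.surjective

/-- The product of two non-degenerate modules is non-degenerate (`E` directed). -/
theorem IsNondegenerate.prod (hE : IsDirectedIdempotents E) {N : Type*} [AddCommGroup N]
    [Module R N] (hM : IsNondegenerate E M) (hN : IsNondegenerate E N) :
    IsNondegenerate E (M × N) := by
  rintro ⟨m, n⟩
  obtain ⟨e, he, hm⟩ := hM m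
  obtain ⟨f, hf, hn⟩ := hN n
  obtain ⟨g, hg, hge, hgf⟩ := hE.directed e he f hf
  exact ⟨g, hg, Prod.ext (smul_eq_self_of_idemLE hge hm) (smul_eq_self_of_idemLE hgf hn)⟩

/-- Non-degeneracy over a smaller family implies non-degeneracy over a larger one. -/
theorem IsNondegenerate.mono {E' : Set R} (hEE' : E ⊆ E') (h : IsNondegenerate E M) :
    IsNondegenerate E' M :=
  fun m => let ⟨e, he, hm⟩ := h m; ⟨e, hEE' he, hm⟩

end Abstract

section Level

open Summit.Ventures.HodgeRepro2.LevelPositivity Summit.Ventures.HodgeRepro2.T5LevelIdempotent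

variable {G : Type*} [Group G] {k : Type*} [Field k] [CharZero k] {V : Type*} [AddCommGroup V]
  [Module k V] (ρ : Representation k G V)

omit [CharZero k] in
/-- `K`-finiteness passes to subgroups. -/
theorem kFinite_of_le {K' K : Subgroup G} (hle : K' ≤ K) (hK : KFinite ρ K) : KFinite ρ K' := by
  intro v
  have h : (stabilizer ρ v).relIndex K ≠ 0 := (hK v).index_ne_zero
  exact ⟨fun h0 => h (Subgroup.relIndex_eq_zero_of_le_right hle h0)⟩

/-- The family of level idempotents `e_K`, `K ∈ 𝒦`, inside `End_k V`. -/
def levelIdempotents (𝒦 : Set (Subgroup G)) (h𝒦 : ∀ K ∈ 𝒦, KFinite ρ K) :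
    Set (Module.End k V) :=
  {e | ∃ K, ∃ hK : K ∈ 𝒦, e = levelIdempotent K (h𝒦 K hK)}

/-- For `K' ≤ K`: `e_K ≼ e_{K'}` (the smaller the level, the larger the idempotent). -/
theorem idemLE_levelIdempotent_of_le {K' K : Subgroup G} (hle : K' ≤ K) (hK' : KFinite ρ K')
    (hK : KFinite ρ K) :
    IdemLE (levelIdempotent (ρ := ρ) K hK) (levelIdempotent (ρ := ρ) K' hK') :=
  ⟨mul_levelIdempotent_of_le ρ hle hK' hK, levelIdempotent_mul_of_le ρ hle hK' hK⟩

/-- The level idempotents of a non-empty family `𝒦` closed under common lower bounds form a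
directed family of idempotents. -/
theorem isDirectedIdempotents_levelIdempotents (𝒦 : Set (Subgroup G))
    (h𝒦 : ∀ K ∈ 𝒦, KFinite ρ K) (hne : 𝒦.Nonempty)
    (hinf : ∀ K ∈ 𝒦, ∀ K' ∈ 𝒦, ∃ K'' ∈ 𝒦, K'' ≤ K ∧ K'' ≤ K') :
    IsDirectedIdempotents (levelIdempotents ρ 𝒦 h𝒦) where
  nonempty := by
    obtain ⟨K, hK⟩ := hne
    exact ⟨_, K, hK, rfl⟩
  idem := by
    rintro _ ⟨K, hK, rfl⟩
    exact isIdempotentElem_levelIdempotent ρ K _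
  directed := by
    rintro _ ⟨K, hK, rfl⟩ _ ⟨K', hK', rfl⟩
    obtain ⟨K'', hK'', h₁, h₂⟩ := hinf K hK K' hK'
    exact ⟨_, ⟨K'', hK'', rfl⟩, idemLE_levelIdempotent_of_le ρ h₁ _ _,
      idemLE_levelIdempotent_of_le ρ h₂ _ _⟩

/-- `V` is non-degenerate over the level idempotents iff every vector is fixed by some `K ∈ 𝒦`. -/
theorem isNondegenerate_levelIdempotents_iff (𝒦 : Set (Subgroup G))
    (h𝒦 : ∀ K ∈ 𝒦, KFinite ρ K) :
    IsNondegenerate (levelIdempotents ρ 𝒦 h𝒦) V ↔ ∀ v : V, ∃ K ∈ 𝒦, v ∈ invariants ρ K := by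
  constructor
  · intro h v
    obtain ⟨_, ⟨K, hK, rfl⟩, hv⟩ := h v
    haveI := h𝒦 K hK v
    refine ⟨K, hK, ?_⟩
    rw [Module.End.smul_def, levelIdempotent_apply] at hv
    exact levelAverage_eq_self_iff.1 hv
  · intro h v
    obtain ⟨K, hK, hv⟩ := h v
    refine ⟨_, ⟨K, hK, rfl⟩, ?_⟩
    rw [Module.End.smul_def, levelIdempotent_apply]
    exact levelAverage_of_mem_invariants hv

variable [TopologicalSpace G] [IsTopologicalGroup G]

omit [IsTopologicalGroup G] in
/-- Smooth ⇒ non-degenerate over the level idempotents of a family `𝒦` cofinal among the open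
subgroups. -/
theorem isNondegenerate_of_isSmooth (hρ : IsSmooth ρ) (𝒦 : Set (Subgroup G))
    (h𝒦 : ∀ K ∈ 𝒦, KFinite ρ K)
    (hcof : ∀ U : Subgroup G, IsOpen (U : Set G) → ∃ K ∈ 𝒦, K ≤ U) :
    IsNondegenerate (levelIdempotents ρ 𝒦 h𝒦) V := by
  rw [isNondegenerate_levelIdempotents_iff]
  intro v
  obtain ⟨K, hK, hle⟩ := hcof (stabilizer ρ v) (hρ v)
  exact ⟨K, hK, mem_invariants_iff.2 fun g hg => mem_stabilizer_iff.1 (hle hg)⟩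

/-- Non-degenerate over the level idempotents of a family of OPEN subgroups ⇒ smooth. -/
theorem isSmooth_of_isNondegenerate (𝒦 : Set (Subgroup G)) (h𝒦 : ∀ K ∈ 𝒦, KFinite ρ K)
    (hopen : ∀ K ∈ 𝒦, IsOpen (K : Set G))
    (h : IsNondegenerate (levelIdempotents ρ 𝒦 h𝒦) V) : IsSmooth ρ := by
  rw [isNondegenerate_levelIdempotents_iff] at h
  intro v
  obtain ⟨K, hK, hv⟩ := h v
  exact Subgroup.isOpen_mono (fun g hg => mem_stabilizer_iff.2 (mem_invariants_iff.1 hv g hg))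
    (hopen K hK)

/-- The dictionary: for a family `𝒦` of open subgroups cofinal among the open subgroups (e.g. the
compact open subgroups of a totally disconnected group), `ρ` is smooth iff `V` is non-degenerate
over the level idempotents `e_K`, `K ∈ 𝒦`. -/
theorem isSmooth_iff_isNondegenerate (𝒦 : Set (Subgroup G)) (h𝒦 : ∀ K ∈ 𝒦, KFinite ρ K)
    (hopen : ∀ K ∈ 𝒦, IsOpen (K : Set G))
    (hcof : ∀ U : Subgroup G, IsOpen (U : Set G) → ∃ K ∈ 𝒦, K ≤ U) :
    IsSmooth ρ ↔ IsNondegenerate (levelIdempotents ρ 𝒦 h𝒦) V :=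
  ⟨fun hρ => isNondegenerate_of_isSmooth ρ hρ 𝒦 h𝒦 hcof,
    fun h => isSmooth_of_isNondegenerate ρ 𝒦 h𝒦 hopen h⟩

omit [CharZero k] in
/-- For a smooth `ρ` and a family of compact subgroups, the `K`-finiteness hypothesis of
`levelIdempotents` holds automatically. -/
theorem kFinite_of_isSmooth_of_mem (hρ : IsSmooth ρ) (𝒦 : Set (Subgroup G))
    (hcpt : ∀ K ∈ 𝒦, IsCompact (K : Set G)) : ∀ K ∈ 𝒦, KFinite ρ K :=
  fun K hK => kFinite_of_isSmooth hρ (hcpt K hK)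

end Level

end Summit.Ventures.HodgeRepro2.T5DirectedIdempotents
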